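import Summits.QuantumFields.YangMills.Theorems.TwistedTraceScaling.Negative.LabelLimitPointwise
import Summits.QuantumFields.YangMills.Theorems.TwistedTraceScaling.Negative.TraceRatioMonotone
import Summits.QuantumFields.YangMills.Theorems.TwistedTraceScaling.Negative.ClockRobustness
import HarnessLib

/-!
# The window-free label limit LIM (⟺ the open stub CMP-2LOOP, R75): the size-TAIL form, the `s`-COMPACT-UNIFORM form and the
# INVERSE-RUNNING-COUPLING form are free —
# crux disprover, cycle 63 (route `LuscherReduction`, crux `TwistedTraceScaling` stmt-QuantumFields-20203; `--supports`, helper only)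

R75 (`Negative/UniformAllSizes.lean`) certified `TwoLattice.Stmt.stub_cmpTwoLoop ⟺ LIM`,
  LIM:  `∀ s ε, ∃ Λ0 > 0, ∀ L ≥ 1, ∀ β, 1 ≤ β → 0 < Λ(β, L) → Λ(β, L) ≤ Λ0 → |r_L(β, ⌈sL/Λ(β,L)⌉) − r_𝔥(s)| ≤ ε`,
R75c (`Negative/LabelLimitPointwise.lean`) proved LIM POINTWISE in `L` (`Λ0 = Λ0(L, s, ε)`), so the open stub is exactly the quantifier swap
`∃ Λ0 ∀ L`.  This file certifies three further FREE restatements of that swap (regime (bi)(iv) of the disprover's work file), so that a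
planner of a skeleton rev 4 may choose any of them without changing content:

* ★ `labelLimit_iff_tail` — **LIM is a statement about `L → ∞` only**: LIM ⟺ TAIL, the same text behind a size threshold `∃ L0(s, ε), ∀ L ≥ L0`
  chosen together with `Λ0` (the finitely many sizes below `L0` are theorems, `R75c.labelLimit_pointwise`; a finite minimum of positive depths is
  positive).  Contrast: a threshold does NOT rescue either guard (`R75c.labelLimit_false_without_betaGeOne_keeping_threshold`,
  `R75c.labelLimit_false_without_lambdaPos_keeping_threshold`).
* ★ `labelLimit_compactUniform` ∕ `labelLimit_iff_compactUniform` — **local uniformity in the femto time is free**: LIM ⟹ for every compact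
  `[a, b] ⊂ (0, ∞)` ONE depth `Λ0(a, b, ε)` serves all `s ∈ [a, b]` (Pólya's argument: at fixed `(L, β)` the lattice side
  `s ↦ r_L(β, ⌈sL/Λ⌉)` is NON-DECREASING — the clock `⌈sL/Λ⌉` is monotone in `s` and ✓`traceRatio_mono` (log-convex level moments, `T ≥ 2`,
  `β ≥ 1`) — while `r_𝔥` is uniformly continuous on `[a, b + 1]` (✓`continuousAt_hTraceRatio`); LIM at the finitely many points of a `δ`-grid
  sandwiches every `s` in between).  NOT certified and NOT to be smuggled into a rev 4: uniformity down to `s → 0⁺`, a rate in `Λ`, an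
  `ε`-free depth.
* ★ `labelLimit_iff_invCouplingForm` — **the femto threshold measured in the inverse running coupling**: LIM ⟺
  `∀ s ε, ∃ X0, ∀ L ≥ 1, ∀ β ≥ 1, X0 ≤ 1/ḡ²(β, L) → |r_L − r_𝔥(s)| ≤ ε` with `1/ḡ²(β, L) = β/2 − 2b₀ log L + (b₁/b₀) log(2b₀/β)`
  (✓`BOHandover.invRunningCoupling_eq`; `Λ³ = ḡ²`, ✓`BOHandover.luscherLambda_pow_three`): CMP-2LOOP says that S-BASE's threshold in `β` may be
  taken ON ONE two-loop asymptotic-scaling trajectory `β/2 + (b₁/b₀) log(2b₀/β) ≥ X0(s, ε) + 2b₀ log L` for ALL lattice sizes — the reading in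
  which the `L`-uniformity is the statement that Lüscher's small-volume expansion is asymptotic UNIFORMLY IN THE CUTOFF along the scaling
  trajectory (continuum limit of the femto universe at fixed two-loop label).
* `cmpTwoLoop_iff_tail`, `cmpTwoLoop_iff_compactUniform`, `cmpTwoLoop_iff_invCouplingForm` — the same three forms for the registered stub
  `Stmt.stub_cmpTwoLoop` (through ✓`R75.cmpTwoLoop_iff_labelLimit`).

HONEST FRAMING: structural facts about a hypothesis text equivalent to an OPEN stub of a child of the CONDITIONAL reduction route R2b1; the
crux `TwistedTraceScaling` is NOT refuted and NOT closed; fixed-lattice statements only — not infinite volume, not a mass gap, not Clay.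
No definitions, no `sorry`.
-/

set_option autoImplicit false

noncomputable section

open MeasureTheory Filter Topology Real
open Literature.MathematicalPhysics.QuantumFieldTheory hiding SU2
open Literature.MathematicalPhysics.QuantumLattice
open Literature.Analysis.OperatorTheory.YMMatrixModel
open scoped BigOperators

namespace Summit.QuantumFields.YangMills.Theorems.TwistedTraceScaling.Negative

open Summit.QuantumFields.YangMills.Theorems.FemtoTransferGap
open Summit.QuantumFields.YangMills.Theorems.FemtoTransferGap.TraceDoor
open Summit.QuantumFields.YangMills.Theorems.FemtoTransferGap.TT
open Summit.QuantumFields.YangMills.Theorems.FemtoTransferGap.TwoLattice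

namespace R76

/-! ## §1 ★ LIM ⟺ TAIL: a size threshold chosen with the depth carries no content -/

/-- ★ **LIM is a statement about `L → ∞` only.**  The window-free label limit with an `L`-uniform depth `Λ0(s, ε)` is equivalent to the same
text asserted only for `L ≥ L0(s, ε)`: the sizes `1 ≤ L < L0` are supplied by the pointwise theorem `R75c.labelLimit_pointwise`
(S-BASE), and the minimum of finitely many positive depths is positive. [folklore] -/
theorem labelLimit_iff_tail :
    (∀ s : ℝ, 0 < s → ∀ ε : ℝ, 0 < ε → ∃ Λ0 : ℝ, 0 < Λ0 ∧
      ∀ (L : ℕ) [NeZero L], ∀ β : ℝ, 1 ≤ β → 0 < luscherLambda β L → luscherLambda β L ≤ Λ0 →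
        |traceRatio L β (femtoSteps s β L) - hTraceRatio s| ≤ ε) ↔
    (∀ s : ℝ, 0 < s → ∀ ε : ℝ, 0 < ε → ∃ Λ0 : ℝ, 0 < Λ0 ∧ ∃ L0 : ℕ,
      ∀ (L : ℕ) [NeZero L], L0 ≤ L → ∀ β : ℝ, 1 ≤ β → 0 < luscherLambda β L → luscherLambda β L ≤ Λ0 →
        |traceRatio L β (femtoSteps s β L) - hTraceRatio s| ≤ ε) := by
  constructor
  · intro h s hs ε hε
    obtain ⟨Λ0, hΛ0, H⟩ := h s hs ε hε
    exact ⟨Λ0, hΛ0, 0, fun L _ _ β hβ hpos hle => H L β hβ hpos hle⟩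
  · intro h s hs ε hε
    obtain ⟨Λ0, hΛ0, L0, H⟩ := h s hs ε hε
    -- pointwise depths at the sizes `n + 1`, `n ≤ L0`
    have hpt : ∀ n : ℕ, ∃ Λ1 : ℝ, 0 < Λ1 ∧
        ∀ β : ℝ, 1 ≤ β → 0 < luscherLambda β (n + 1) → luscherLambda β (n + 1) ≤ Λ1 →
          |traceRatio (n + 1) β (femtoSteps s β (n + 1)) - hTraceRatio s| ≤ ε :=
      fun n => R75c.labelLimit_pointwise (n + 1) s hs ε hε
    choose G hG using hpt
    have hne : (Finset.range (L0 + 1)).Nonempty := ⟨0, by simp⟩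
    refine ⟨min Λ0 ((Finset.range (L0 + 1)).inf' hne G), lt_min hΛ0 ?_, fun L _ β hβ hpos hle => ?_⟩
    · exact (Finset.lt_inf'_iff hne).mpr fun n _ => (hG n).1
    · rcases Nat.lt_or_ge L L0 with hlt | hge
      · obtain ⟨n, rfl⟩ := Nat.exists_eq_succ_of_ne_zero (NeZero.ne L)
        have hn : n ∈ Finset.range (L0 + 1) := Finset.mem_range.mpr (by omega)
        have hGn : min Λ0 ((Finset.range (L0 + 1)).inf' hne G) ≤ G n :=
          (min_le_right _ _).trans (Finset.inf'_le G hn)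
        exact (hG n).2 β hβ hpos (hle.trans hGn)
      · exact H L hge β hβ hpos (hle.trans (min_le_left _ _))

/-! ## §2 ★ LIM ⟹ uniformity on compact femto-time intervals (Pólya) -/

/-- The clock is monotone in the femto time: `s ≤ s' → ⌈sL/Λ⌉ ≤ ⌈s'L/Λ⌉` (`Λ = Λ(β, L) ≥ 0`). [folklore] -/
theorem femtoSteps_mono {s s' : ℝ} (hss' : s ≤ s') (β : ℝ) (L : ℕ) :
    femtoSteps s β L ≤ femtoSteps s' β L := by
  unfold femtoSteps
  apply Nat.ceil_mono
  have hΛ : 0 ≤ luscherLambda β L := by unfold luscherLambda; positivity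
  exact div_le_div_of_nonneg_right (mul_le_mul_of_nonneg_right hss' (Nat.cast_nonneg L)) hΛ

/-- In the window `0 < Λ(β, L) ≤ a/2` every clock at femto time `s ≥ a` has at least two steps (`sL/Λ ≥ a/Λ ≥ 2 > 1`). [folklore] -/
theorem two_le_femtoSteps {a s : ℝ} (ha : 0 < a) (has : a ≤ s) {β : ℝ} {L : ℕ} [NeZero L]
    (hpos : 0 < luscherLambda β L) (hle : luscherLambda β L ≤ a / 2) :
    2 ≤ femtoSteps s β L := by
  unfold femtoSteps
  have hL1 : (1 : ℝ) ≤ (L : ℝ) := by exact_mod_cast NeZero.one_le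
  have h1 : (1 : ℝ) < s * L / luscherLambda β L := by
    rw [lt_div_iff₀ hpos]
    nlinarith
  have h2 : 1 < ⌈s * L / luscherLambda β L⌉₊ := Nat.lt_ceil.mpr (by exact_mod_cast h1)
  omega

/-- ★ **Local uniformity in the femto time is free (Pólya).**  If LIM holds then for every compact `[a, b] ⊂ (0, ∞)` and `ε > 0` ONE depth
`Λ0(a, b, ε) > 0` serves every `s ∈ [a, b]`: at fixed `(L, β)` the lattice side `s ↦ r_L(β, ⌈sL/Λ⌉)` is non-decreasing (`femtoSteps_mono`,
✓`traceRatio_mono` for `β ≥ 1`, `T ≥ 2`), `r_𝔥` is uniformly continuous on `[a, b + 1]` (✓`continuousAt_hTraceRatio`), and LIM at the points of a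
`δ`-grid `a + iδ'` (finitely many, tolerance `ε/2`) sandwiches every `s` between two neighbouring grid points. [folklore] -/
theorem labelLimit_compactUniform
    (h : ∀ s : ℝ, 0 < s → ∀ ε : ℝ, 0 < ε → ∃ Λ0 : ℝ, 0 < Λ0 ∧
      ∀ (L : ℕ) [NeZero L], ∀ β : ℝ, 1 ≤ β → 0 < luscherLambda β L → luscherLambda β L ≤ Λ0 →
        |traceRatio L β (femtoSteps s β L) - hTraceRatio s| ≤ ε)
    {a : ℝ} (b : ℝ) (ha : 0 < a) :
    ∀ ε : ℝ, 0 < ε → ∃ Λ0 : ℝ, 0 < Λ0 ∧ ∀ s : ℝ, a ≤ s → s ≤ b →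
      ∀ (L : ℕ) [NeZero L], ∀ β : ℝ, 1 ≤ β → 0 < luscherLambda β L → luscherLambda β L ≤ Λ0 →
        |traceRatio L β (femtoSteps s β L) - hTraceRatio s| ≤ ε := by
  intro ε hε
  -- uniform continuity of `r_𝔥` on `[a, b + 1]`
  have hcont : ContinuousOn hTraceRatio (Set.Icc a (b + 1)) := fun x hx =>
    (continuousAt_hTraceRatio (lt_of_lt_of_le ha hx.1)).continuousWithinAt
  have huc : UniformContinuousOn hTraceRatio (Set.Icc a (b + 1)) := isCompact_Icc.uniformContinuousOn_of_continuous hcont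
  obtain ⟨δ, hδ, hδc⟩ := Metric.uniformContinuousOn_iff.mp huc (ε / 2) (by positivity)
  -- the grid `g i = a + i δ'`, `δ' = min (δ/2) 1`
  obtain ⟨δ', hδ'⟩ : ∃ δ' : ℝ, δ' = min (δ / 2) 1 := ⟨_, rfl⟩
  have hδ'pos : 0 < δ' := by rw [hδ']; exact lt_min (by positivity) one_pos
  have hδ'δ : δ' < δ := by rw [hδ']; linarith [min_le_left (δ / 2) 1]
  have hδ'1 : δ' ≤ 1 := by rw [hδ']; exact min_le_right _ _
  obtain ⟨g, hg⟩ : ∃ g : ℕ → ℝ, g = fun i : ℕ => a + (i : ℝ) * δ' := ⟨_, rfl⟩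
  have hstep : ∀ i : ℕ, g (i + 1) = g i + δ' := fun i => by rw [hg]; push_cast; ring
  have hgpos : ∀ i : ℕ, 0 < g i := fun i => by rw [hg]; positivity
  have hga : ∀ i : ℕ, a ≤ g i := fun i => by rw [hg]; simp only; nlinarith [hδ'pos.le, (Nat.cast_nonneg i : (0:ℝ) ≤ i)]
  -- LIM at the grid points, tolerance `ε/2`
  have hgrid : ∀ i : ℕ, ∃ Λ1 : ℝ, 0 < Λ1 ∧
      ∀ (L : ℕ) [NeZero L], ∀ β : ℝ, 1 ≤ β → 0 < luscherLambda β L → luscherLambda β L ≤ Λ1 →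
        |traceRatio L β (femtoSteps (g i) β L) - hTraceRatio (g i)| ≤ ε / 2 :=
    fun i => h (g i) (hgpos i) (ε / 2) (by positivity)
  choose G hG using hgrid
  obtain ⟨N, hN⟩ : ∃ N : ℕ, N = ⌈(b - a) / δ'⌉₊ := ⟨_, rfl⟩
  have hne : (Finset.range (N + 2)).Nonempty := ⟨0, by simp⟩
  refine ⟨min (a / 2) ((Finset.range (N + 2)).inf' hne G), lt_min (by positivity) ?_, ?_⟩
  · exact (Finset.lt_inf'_iff hne).mpr fun n _ => (hG n).1
  intro s has hsb L _ β hβ hpos hle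
  have hle_a : luscherLambda β L ≤ a / 2 := hle.trans (min_le_left _ _)
  have hGi : ∀ i ∈ Finset.range (N + 2), luscherLambda β L ≤ G i := fun i hi =>
    hle.trans ((min_le_right _ _).trans (Finset.inf'_le G hi))
  -- the cell of `s`: `g i ≤ s < g (i+1)`, `i ≤ N`
  obtain ⟨i, hi⟩ : ∃ i : ℕ, i = ⌊(s - a) / δ'⌋₊ := ⟨_, rfl⟩
  have hsa : 0 ≤ (s - a) / δ' := div_nonneg (by linarith) hδ'pos.le
  have hfl : (i : ℝ) ≤ (s - a) / δ' := by rw [hi]; exact Nat.floor_le hsa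
  have hfl' : (s - a) / δ' < i + 1 := by rw [hi]; exact Nat.lt_floor_add_one _
  have hgi_le : g i ≤ s := by
    rw [hg]; simp only
    have := mul_le_mul_of_nonneg_right hfl hδ'pos.le
    rw [div_mul_cancel₀ _ hδ'pos.ne'] at this
    linarith
  have hgi1_gt : s < g (i + 1) := by
    rw [hg]; simp only
    have := mul_lt_mul_of_pos_right hfl' hδ'pos
    rw [div_mul_cancel₀ _ hδ'pos.ne'] at this
    push_cast
    linarith
  have hgi1_le : g (i + 1) ≤ s + δ' := by
    rw [hg]; simp only; push_cast
    have := mul_le_mul_of_nonneg_right hfl hδ'pos.le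
    rw [div_mul_cancel₀ _ hδ'pos.ne'] at this
    nlinarith
  have hiN : i ≤ N := by
    rw [hi, hN]
    exact (Nat.floor_le_floor (div_le_div_of_nonneg_right (by linarith) hδ'pos.le)).trans (Nat.floor_le_ceil _)
  have hi_mem : i ∈ Finset.range (N + 2) := Finset.mem_range.mpr (by omega)
  have hi1_mem : i + 1 ∈ Finset.range (N + 2) := Finset.mem_range.mpr (by omega)
  -- LIM at the two neighbouring grid points
  have hA := (hG i).2 L β hβ hpos (hGi i hi_mem)
  have hB := (hG (i + 1)).2 L β hβ hpos (hGi (i + 1) hi1_mem)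
  -- monotone lattice side
  have hT2 : 2 ≤ femtoSteps (g i) β L := two_le_femtoSteps ha (hga i) hpos hle_a
  have hT2s : 2 ≤ femtoSteps s β L := two_le_femtoSteps ha has hpos hle_a
  have hm1 : traceRatio L β (femtoSteps (g i) β L) ≤ traceRatio L β (femtoSteps s β L) :=
    traceRatio_mono L hβ hT2 (femtoSteps_mono hgi_le β L)
  have hm2 : traceRatio L β (femtoSteps s β L) ≤ traceRatio L β (femtoSteps (g (i + 1)) β L) :=
    traceRatio_mono L hβ hT2s (femtoSteps_mono hgi1_gt.le β L)
  -- uniform continuity of `r_𝔥` at the two grid points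
  have hs_mem : s ∈ Set.Icc a (b + 1) := ⟨has, by linarith⟩
  have hgi_mem : g i ∈ Set.Icc a (b + 1) := ⟨hga i, by linarith⟩
  have hgi1_mem : g (i + 1) ∈ Set.Icc a (b + 1) := ⟨hga (i + 1), by linarith⟩
  have hc1 := hδc s hs_mem (g i) hgi_mem (by rw [Real.dist_eq, abs_of_nonneg (by linarith)]; linarith [hstep i])
  have hc2 := hδc s hs_mem (g (i + 1)) hgi1_mem (by rw [Real.dist_eq, abs_of_nonpos (by linarith)]; linarith)
  rw [Real.dist_eq] at hc1 hc2
  rw [abs_lt] at hc1 hc2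
  rw [abs_le] at hA hB ⊢
  constructor <;> linarith [hA.1, hB.2, hc1.1, hc1.2, hc2.1, hc2.2]

/-- ★ **LIM ⟺ its `s`-compact-uniform form** (one depth for all `s ∈ [a, b]`, any `0 < a`, any `b`; the converse takes `a = b = s`). [folklore] -/
theorem labelLimit_iff_compactUniform :
    (∀ s : ℝ, 0 < s → ∀ ε : ℝ, 0 < ε → ∃ Λ0 : ℝ, 0 < Λ0 ∧
      ∀ (L : ℕ) [NeZero L], ∀ β : ℝ, 1 ≤ β → 0 < luscherLambda β L → luscherLambda β L ≤ Λ0 →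
        |traceRatio L β (femtoSteps s β L) - hTraceRatio s| ≤ ε) ↔
    (∀ a b : ℝ, 0 < a → ∀ ε : ℝ, 0 < ε → ∃ Λ0 : ℝ, 0 < Λ0 ∧ ∀ s : ℝ, a ≤ s → s ≤ b →
      ∀ (L : ℕ) [NeZero L], ∀ β : ℝ, 1 ≤ β → 0 < luscherLambda β L → luscherLambda β L ≤ Λ0 →
        |traceRatio L β (femtoSteps s β L) - hTraceRatio s| ≤ ε) := by
  constructor
  · intro h a b ha
    exact labelLimit_compactUniform h b ha
  · intro h s hs ε hε
    obtain ⟨Λ0, hΛ0, H⟩ := h s s hs ε hε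
    exact ⟨Λ0, hΛ0, fun L _ β hβ hpos hle => H s le_rfl le_rfl L β hβ hpos hle⟩

/-! ## §3 The registered stub in the two free forms -/

/-- **CMP-2LOOP ⟺ TAIL**: the registered stub `Stmt.stub_cmpTwoLoop` is the window-free label limit behind an arbitrary size threshold
`∃ L0(s, ε)` chosen with the depth (✓`R75.cmpTwoLoop_iff_labelLimit`, `labelLimit_iff_tail`). [cite: Luscher1983, §3] -/
theorem cmpTwoLoop_iff_tail :
    Stmt.stub_cmpTwoLoop ↔
    (∀ s : ℝ, 0 < s → ∀ ε : ℝ, 0 < ε → ∃ Λ0 : ℝ, 0 < Λ0 ∧ ∃ L0 : ℕ,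
      ∀ (L : ℕ) [NeZero L], L0 ≤ L → ∀ β : ℝ, 1 ≤ β → 0 < luscherLambda β L → luscherLambda β L ≤ Λ0 →
        |traceRatio L β (femtoSteps s β L) - hTraceRatio s| ≤ ε) :=
  R75.cmpTwoLoop_iff_labelLimit.trans labelLimit_iff_tail

/-- **CMP-2LOOP ⟺ the `s`-compact-uniform label limit**: one depth `Λ0(a, b, ε)` for all femto times `s ∈ [a, b] ⊂ (0, ∞)`, uniformly in the
lattice size (✓`R75.cmpTwoLoop_iff_labelLimit`, `labelLimit_iff_compactUniform`). [cite: Luscher1983, §3] -/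
theorem cmpTwoLoop_iff_compactUniform :
    Stmt.stub_cmpTwoLoop ↔
    (∀ a b : ℝ, 0 < a → ∀ ε : ℝ, 0 < ε → ∃ Λ0 : ℝ, 0 < Λ0 ∧ ∀ s : ℝ, a ≤ s → s ≤ b →
      ∀ (L : ℕ) [NeZero L], ∀ β : ℝ, 1 ≤ β → 0 < luscherLambda β L → luscherLambda β L ≤ Λ0 →
        |traceRatio L β (femtoSteps s β L) - hTraceRatio s| ≤ ε) :=
  R75.cmpTwoLoop_iff_labelLimit.trans labelLimit_iff_compactUniform

/-! ## §4 LIM in the inverse running coupling: the femto threshold measured in `1/ḡ²(β, L)` -/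

/-- On the asymptotically free side the label window is a half-line in the inverse running coupling:
`0 < Λ(β, L) ≤ Λ0 ⟹ (Λ0³)⁻¹ ≤ 1/ḡ²(β, L)` (`Λ³ = ḡ²`, ✓`BOHandover.luscherLambda_pow_three`). [cite: LuscherMunster1984, §2] -/
theorem inv_cube_le_invRunningCoupling {β Λ0 : ℝ} {L : ℕ}
    (hpos : 0 < luscherLambda β L) (hle : luscherLambda β L ≤ Λ0) :
    (Λ0 ^ 3)⁻¹ ≤ invRunningCoupling β L := by
  have hx : 0 < invRunningCoupling β L := BOHandover.invRunningCoupling_pos_of_luscherLambda_pos hpos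
  have h3 : luscherLambda β L ^ 3 = (invRunningCoupling β L)⁻¹ := BOHandover.luscherLambda_pow_three hx
  have hcube : luscherLambda β L ^ 3 ≤ Λ0 ^ 3 := pow_le_pow_left₀ hpos.le hle 3
  rw [h3] at hcube
  have := inv_anti₀ (by positivity) hcube
  rwa [inv_inv] at this

/-- Conversely `0 < X0 ≤ 1/ḡ²(β, L) ⟹ 0 < Λ(β, L) ≤ (X0⁻¹)^{1/3}`. [cite: LuscherMunster1984, §2] -/
theorem luscherLambda_le_of_le_invRunningCoupling {β X0 : ℝ} {L : ℕ} (hX0 : 0 < X0)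
    (hx : X0 ≤ invRunningCoupling β L) :
    0 < luscherLambda β L ∧ luscherLambda β L ≤ (X0⁻¹) ^ ((1 : ℝ) / 3) := by
  have hxpos : 0 < invRunningCoupling β L := lt_of_lt_of_le hX0 hx
  have hΛpos : 0 < luscherLambda β L := by
    unfold luscherLambda
    rw [max_eq_left hxpos.le]
    exact Real.rpow_pos_of_pos hxpos _
  refine ⟨hΛpos, ?_⟩
  have h3 : luscherLambda β L ^ 3 = (invRunningCoupling β L)⁻¹ := BOHandover.luscherLambda_pow_three hxpos
  have hR : ((X0⁻¹) ^ ((1 : ℝ) / 3)) ^ 3 = X0⁻¹ := by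
    rw [show ((1 : ℝ) / 3) = ((3 : ℕ) : ℝ)⁻¹ by norm_num]
    exact Real.rpow_inv_natCast_pow (by positivity) (by norm_num)
  have hcube : luscherLambda β L ^ 3 ≤ ((X0⁻¹) ^ ((1 : ℝ) / 3)) ^ 3 := by
    rw [h3, hR]
    exact inv_anti₀ hX0 hx
  exact le_of_pow_le_pow_left₀ (by norm_num) (by positivity) hcube

/-- ★ **LIM ⟺ the femto threshold is `L`-uniform when measured in the inverse running coupling**:
`∀ s ε, ∃ X0, ∀ L ≥ 1, ∀ β ≥ 1, X0 ≤ 1/ḡ²(β, L) → |r_L(β, ⌈sL/Λ⌉) − r_𝔥(s)| ≤ ε`, where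
`1/ḡ²(β, L) = β/2 − 2b₀ log L + (b₁/b₀) log(2b₀/β)` (✓`BOHandover.invRunningCoupling_eq`) — i.e. S-BASE's threshold in `β` may be taken of the form
`2X0(s, ε) + 4b₀ log L + (2b₁/b₀) log(β/(2b₀))`, the two-loop asymptotic-scaling trajectory, with `X0` INDEPENDENT of `L`. [cite: LuscherMunster1984, §2] -/
theorem labelLimit_iff_invCouplingForm :
    (∀ s : ℝ, 0 < s → ∀ ε : ℝ, 0 < ε → ∃ Λ0 : ℝ, 0 < Λ0 ∧
      ∀ (L : ℕ) [NeZero L], ∀ β : ℝ, 1 ≤ β → 0 < luscherLambda β L → luscherLambda β L ≤ Λ0 →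
        |traceRatio L β (femtoSteps s β L) - hTraceRatio s| ≤ ε) ↔
    (∀ s : ℝ, 0 < s → ∀ ε : ℝ, 0 < ε → ∃ X0 : ℝ, 0 < X0 ∧
      ∀ (L : ℕ) [NeZero L], ∀ β : ℝ, 1 ≤ β → X0 ≤ invRunningCoupling β L →
        |traceRatio L β (femtoSteps s β L) - hTraceRatio s| ≤ ε) := by
  constructor
  · intro h s hs ε hε
    obtain ⟨Λ0, hΛ0, H⟩ := h s hs ε hε
    refine ⟨(Λ0 ^ 3)⁻¹, by positivity, fun L _ β hβ hx => ?_⟩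
    obtain ⟨hpos, hle⟩ := luscherLambda_le_of_le_invRunningCoupling (by positivity) hx
    refine H L β hβ hpos (hle.trans (le_of_eq ?_))
    rw [inv_inv, show ((1 : ℝ) / 3) = ((3 : ℕ) : ℝ)⁻¹ by norm_num]
    exact Real.pow_rpow_inv_natCast hΛ0.le (by norm_num)
  · intro h s hs ε hε
    obtain ⟨X0, hX0, H⟩ := h s hs ε hε
    refine ⟨(X0⁻¹) ^ ((1 : ℝ) / 3), Real.rpow_pos_of_pos (by positivity) _, fun L _ β hβ hpos hle => ?_⟩
    refine H L β hβ ?_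
    have h1 := inv_cube_le_invRunningCoupling hpos hle
    have hR : ((X0⁻¹) ^ ((1 : ℝ) / 3)) ^ 3 = X0⁻¹ := by
      rw [show ((1 : ℝ) / 3) = ((3 : ℕ) : ℝ)⁻¹ by norm_num]
      exact Real.rpow_inv_natCast_pow (by positivity) (by norm_num)
    rwa [hR, inv_inv] at h1

/-- **CMP-2LOOP ⟺ the inverse-running-coupling form** (✓`R75.cmpTwoLoop_iff_labelLimit`, `labelLimit_iff_invCouplingForm`): the registered stub says
that S-BASE's femto thresholds lie on ONE two-loop asymptotic-scaling trajectory `1/ḡ²(β, L) ≥ X0(s, ε)` for all lattice sizes. [cite: LuscherMunster1984, §2] -/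
theorem cmpTwoLoop_iff_invCouplingForm :
    Stmt.stub_cmpTwoLoop ↔
    (∀ s : ℝ, 0 < s → ∀ ε : ℝ, 0 < ε → ∃ X0 : ℝ, 0 < X0 ∧
      ∀ (L : ℕ) [NeZero L], ∀ β : ℝ, 1 ≤ β → X0 ≤ invRunningCoupling β L →
        |traceRatio L β (femtoSteps s β L) - hTraceRatio s| ≤ ε) :=
  R75.cmpTwoLoop_iff_labelLimit.trans labelLimit_iff_invCouplingForm

end R76

end Summit.QuantumFields.YangMills.Theorems.TwistedTraceScaling.Negative

end
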